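import Summits.AtomisticToContinuum.FouriersLaw.Theorems.BondHeatUncertaintyExtensiveSnapshotIrreversibilityEnergyWindowEnergyBudgetFloor
import HarnessLib

/-!
# Bond heat uncertainty — energy window: the costate floor beneath (EBF)

Cell `decomp-a2c`, lens-1 «grading / quantitative ladder», generation 84, crux
`stmt-AtomisticToContinuum-9121` (`ExtensiveSnapshotIrreversibility`, K_fix half, leaf S3), part J.
Part I-B (`…EnergyBudgetFloor`) reduced the binder of record (MC∞) to the measure-free floor
(EBF) `EnergyBudgetGramFloor` (`L ≥ c_θ Θ_θ^{-μ}` along every path).  This file splits (EBF)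
along the tree's costate calculus (`Literature…LangevinChainCostate`: `coDrift`, `dualPair`,
`dualPair_costate_at_tent`, `costate_eq_zero_of_snd_left`) into

  (EBF) ⟸ (CSF) `CostateSamplingFloor` ∧ (COF) `CostateObservabilityFloor` — glue PROVED (§2),

with ONE object: a **path costate** `c = (α, β) : [0, s] → ℝ^{2N}` of the linearised chain along
the driven trajectory `ζ_r = Φ_r(z, B(wp))` (`ċ = G(ζ_r) c` on `(0, s)`, continuous on `[0, s]`;
`IsPathCostate`, exactly the hypotheses of the tree's `dualPair_costate_at_tent`), and its
**left-bath Malliavin form** `2γT_L ∫₀ˢ β_0(r)² dr`.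
* **(CSF)** (sampling; tree-adjacent): if EVERY path costate satisfies
  `η |c(s)|² ≤ 2γT_L ∫₀ˢ β_0²`, then `L(s, z, wp) ≥ η/2`.  This is the load-bearing («≥») half of
  the identification of `L = sup_m λ_min(Γ_m)` with the smallest eigenvalue of the Malliavin
  matrix (critic row 1188, g84 order item 1), restricted to the left bath: `aᵀΓ_m a` is
  `2^{-m} Σ_j ⟨c(s), W_j(s)⟩²` over the skeleton directions (part S `dotProduct_skelGramAt_mulVec`,
  `fderiv_skelFlowMapAt_apply`), each left-bath pairing is `ampL 2^m ∫_cell β_0` (W-7a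
  `dualPair_costate_at_tent`), and the Riemann sums are `≥ ampL² (½ ∫₀ˢ β_0² - 2^{-m} E(c))`
  (`sum_sq_cellIntegral_ge`) with `E(c) ≤ K(z, wp) |c(s)|²` PATHWISE (Grönwall for the costate,
  continuous coefficients on `[0, s]`) — so `F_m ≥ η/2 - 2^{-m} ampL² K` and `L = sup_m F_m⁺ ≥ η/2`.
  The harmonic chain's version is part A `harmonic_gramFloor` (there `K` is a constant).
  [ATTACKABLE-M · the anharmonic replica of parts `…GramSampling` §3 / `…SkeletonGramFloor` §4
  with the path costate in place of `harmCostate`]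
* **(COF)** (observability; the NEW deterministic leaf): along every path and for every path
  costate, `|c(s)|² ≤ K_θ Θ_θ(z, wp)^μ · ∫₀ˢ β_0(r)² dr` (`s ∈ [½, 1]`, `|δ| < δ₀`, SOME `μ`,
  EVERY `θ > 0`).  The quantitative form of the tree's `costate_eq_zero_of_snd_left`
  (`β_0 ≡ 0 ⇒ c ≡ 0`, CEHR Prop. 4.1 linearised): `β ∈ C³` with
  `β''' = -(Hess Φ(q_r))' β - Hess Φ β' + γ 1_B β''`, the tridiagonal site recursion
  `V''(q_{i+1} - q_i) β_{i+1} = β_i'' - γ b_i β_i' + (Hess Φ)_{ii} β_i + (Hess Φ)_{i,i-1} β_{i-1}`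
  (`V'' = 1 + 3βr² ≥ 1`), and Landau–Kolmogorov / Taylor-remainder interpolation on `[0, s]`
  (`‖β_i''‖_∞ ≲ ‖β_i‖_∞^{1/5} ‖β_i'''‖_{L²}^{4/5}`, `‖β_i‖_∞ ≲ ‖β_i‖_{L²}^{1/2} ‖β_i'‖_∞^{1/2}`)
  transfer smallness `β_0 → β_1 → … → β_{N-1}` and to `α_i = γ b_i β_i - β_i'`, hence to
  `|c(s)|`; every a-priori bound (`sup |c|`, `‖Hess Φ(q_·)‖_{L²}`, `‖(Hess Φ(q_·))'‖_{L²}`) is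
  `≤ C_θ Θ_θ |c(s)|` resp. `≤ C_θ Θ_θ` by Young + Jensen, so `K_θ Θ_θ^μ` with `μ` from the
  exponent bookkeeping alone.  [NEW · measure-free · ATTACKABLE-L: one-variable real analysis]
Why neither is a costume: (CSF) carries no observability (true for the uncoupled chain `V ≡ 0`,
where (COF) and (EBF) fail), (COF) carries no Gram matrix / skeleton; both are strictly below
(EBF) in content and glue to it by three lines (§2).  No instance / notation / option; no proof
holes.  References: the tree files above; [cite: CuneoEckmannHairerReyBellet2018, Prop 4.1];
(after EckmannPilletReyBellet1999fluct, §3); (after Nualart2006, §2.3). [folklore]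
-/

noncomputable section

namespace Summit.AtomisticToContinuum.FouriersLaw.Theorems.ExtensiveSnapshotIrreversibility.EnergyWindow

open MeasureTheory Filter Topology Set
open scoped ENNReal NNReal
open Literature.MathematicalPhysics.KineticTheory.HeatConduction Literature.Probability.Process

/-! ## 1. Path costates and the two statements -/

section Statements

variable (ω₂ lam β γ : ℝ) (N : ℕ) (T_L T_R : ℝ)

/-- **A path costate on `[0, s]`**: a solution `c = (α, β)` of the costate (adjoint variational)
equation `ċ(r) = G(ζ_r) c(r)` of the chain along the driven trajectory
`ζ_r = Φ_r(z, B(wp))` on `(0, s)`, continuous on `[0, s]` — exactly the costate hypotheses of the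
tree's `dualPair_costate_at_tent` / `costate_at_eq_zero_of_dyadic`. [folklore] -/
def IsPathCostate (s : ℝ) (z : PhaseSpace N) (wp : WienerPair) (c : ℝ → PhaseSpace N) : Prop :=
  ContinuousOn c (Icc 0 s) ∧
    ∀ r ∈ Ioo 0 s, HasDerivAt c ((pinnedChain ω₂ lam β γ).coDrift N
      ((pinnedChain ω₂ lam β γ).solMap N T_L T_R r z (pairPath wp)) (c r)) r

variable {ω₂ lam β γ N T_L T_R}

/-- Path costates form a cone (scalar multiples of costates are costates). [folklore] -/
theorem IsPathCostate.smul {s : ℝ} {z : PhaseSpace N} {wp : WienerPair} {c : ℝ → PhaseSpace N}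
    (hc : IsPathCostate ω₂ lam β γ N T_L T_R s z wp c) (t : ℝ) :
    IsPathCostate ω₂ lam β γ N T_L T_R s z wp (fun r => t • c r) := by
  refine ⟨hc.1.const_smul t, fun r hr => ?_⟩
  have h := (hc.2 r hr).const_smul t
  have hlin : t • (pinnedChain ω₂ lam β γ).coDrift N
      ((pinnedChain ω₂ lam β γ).solMap N T_L T_R r z (pairPath wp)) (c r) =
      (pinnedChain ω₂ lam β γ).coDrift N
        ((pinnedChain ω₂ lam β γ).solMap N T_L T_R r z (pairPath wp)) (t • c r) := by
    ext j
    · simp [OscillatorChain.coDrift, Finset.mul_sum, mul_assoc, mul_left_comm]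
    · simp only [OscillatorChain.coDrift, Prod.smul_snd, Prod.smul_fst, Pi.smul_apply,
        smul_eq_mul]
      ring
  rw [hlin] at h
  exact h

variable (ω₂ lam β γ)

/-- The body of **(CSF)** at fixed chain parameters: the limit Gram floor dominates (half of)
any frame constant of the left-bath costate forms. [cell-local predicate · formal bookkeeping, not a literature fact] -/
def CostateSamplingFloorBody : Prop :=
  ∀ N : ℕ, (hN : 2 ≤ N) → ∀ T_L T_R : ℝ, 0 < T_L → 0 < T_R → ∀ s : ℝ, 0 < s → s ≤ 1 →
    ∀ (z : PhaseSpace N) (wp : WienerPair) (η : ℝ), 0 ≤ η →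
      (∀ c : ℝ → PhaseSpace N, IsPathCostate ω₂ lam β γ N T_L T_R s z wp c →
          η * dualPair (c s) (c s) ≤
            ampL ω₂ lam β γ T_L ^ 2 * ∫ r in (0 : ℝ)..s, ((c r).2 ⟨0, by omega⟩) ^ 2) →
        ENNReal.ofReal (η / 2) ≤ skelGramLimitFloor ω₂ lam β γ N T_L T_R s z wp

/-- The body of **(COF)** at fixed chain parameters: the quantitative costate observability
inequality with energy-budget constants. [cell-local predicate · formal bookkeeping, not a literature fact] -/
def CostateObservabilityFloorBody : Prop :=
  ∀ T : ℝ, 0 < T → ∀ N : ℕ, (hN : 2 ≤ N) →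
    ∃ μ δ₀ : ℝ, 0 < μ ∧ 0 < δ₀ ∧ ∀ θ : ℝ, 0 < θ → ∃ K : ℝ, 0 < K ∧
      ∀ δ : ℝ, |δ| < δ₀ → ∀ s : ℝ, 1 / 2 ≤ s → s ≤ 1 →
        ∀ (z : PhaseSpace N) (wp : WienerPair) (c : ℝ → PhaseSpace N),
          IsPathCostate ω₂ lam β γ N (T + δ / 2) (T - δ / 2) s z wp c →
            dualPair (c s) (c s) ≤
              K * energyBudget ω₂ lam β γ N (T + δ / 2) (T - δ / 2) θ z wp ^ μ *
                ∫ r in (0 : ℝ)..s, ((c r).2 ⟨0, by omega⟩) ^ 2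

variable {ω₂ lam β γ}

/-- **(CSF) `CostateSamplingFloor`** — for the chain driven at both ends and every path: if every
path costate `c = (α, β)` on `[0, s]` obeys `η |c(s)|² ≤ 2γT_L ∫₀ˢ β_0(r)² dr`, then the limit
Gram floor satisfies `L(s, z, wp) ≥ η/2`.  The «≥» half of the identification of `L` with the
smallest eigenvalue of the Malliavin matrix, restricted to the left bath; pathwise, no
observability content (true for an uncoupled chain).  Intended proof: `aᵀΓ_m a = 2^{-m} Σ_j
⟨c(s), W_j(s)⟩²` (parts S/W-0), left-bath pairings `= ampL 2^m ∫_cell β_0` (W-7a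
`dualPair_costate_at_tent`), Riemann sums `≥ ampL² (½∫₀ˢ β_0² - 2^{-m} E(c))`
(`sum_sq_cellIntegral_ge`) with `E(c) ≤ K(z, wp) |c(s)|²` by Grönwall along the path, and
`L = sup_m F_m⁺`.  Decided for the harmonic chain in the form of part A `harmonic_gramFloor`.
[ATTACKABLE-M · tree-adjacent replica of `…GramSampling` §3 with the path costate; PROVED in
part K `…CostateSamplingFloor`]
(after Nualart2006, §2.3) [route leaf · named hypothesis of this cell, NOT filed as a route item here] -/
def CostateSamplingFloor : Prop :=
  ∀ ω₂ lam β γ : ℝ, 0 < ω₂ → 0 < lam → 0 < β → 0 < γ → CostateSamplingFloorBody ω₂ lam β γ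

/-- **(COF) `CostateObservabilityFloor`** — the deterministic heart beneath (MC∞): there is
`μ > 0` such that for every `θ > 0`, along EVERY driven path and for EVERY path costate
`c = (α, β)` on `[0, s]` (`s ∈ [½, 1]`, `|δ| < δ₀`),
`|c(s)|² ≤ K_θ · Θ_θ(z, wp)^μ · ∫₀ˢ β_0(r)² dr`, `Θ_θ` the exponential energy budget.  The
quantitative form of the tree's `costate_eq_zero_of_snd_left` (CEHR Prop. 4.1 linearised:
`β_0 ≡ 0 ⇒ c ≡ 0`): `β ∈ C³` pathwise, tridiagonal site recursion with `V'' ≥ 1`, and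
Landau–Kolmogorov / Taylor-remainder interpolation on `[0, s]`; all a-priori bounds are
`≤ C_θ Θ_θ` (Young + Jensen), so `θ` enters the constant `K_θ` only and `μ` is exponent
bookkeeping.  Why it might fail: only if some a-priori quantity of the recursion needed a
SUPREMUM in time of the energy (not dominated by `Θ_θ`) — on paper every coefficient enters
through `L²(0, s)` norms.  [NEW · measure-free · ATTACKABLE-L]
(after EckmannPilletReyBellet1999fluct, §3) (after CuneoEckmannHairerReyBellet2018, Prop 4.1) [route leaf · named hypothesis of this cell, NOT filed as a route item here] -/
def CostateObservabilityFloor : Prop :=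
  ∀ ω₂ lam β γ : ℝ, 0 < ω₂ → 0 < lam → 0 < β → 0 < γ → CostateObservabilityFloorBody ω₂ lam β γ

end Statements

/-! ## 2. The glue (CSF) ∧ (COF) ⇒ (EBF) ⇒ (MC∞) — PROVED -/

section Glue

variable {ω₂ lam β γ : ℝ}

/-- **(CSF) ∧ (COF) ⇒ (EBF) at fixed parameters — PROVED**: with `K_θ, μ` from (COF) the frame
constant `η = 2γT_L / (K_θ Θ_θ^μ)` is admissible in (CSF), and `η/2 ≥ (γT/(2K_θ)) Θ_θ^{-μ}`
for `|δ| < T`. [folklore] -/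
theorem energyBudgetGramFloorBody_of_costateFloors (hω : 0 < ω₂) (hl : 0 ≤ lam) (hβ : 0 ≤ β)
    (hγ : 0 < γ) (hS : CostateSamplingFloorBody ω₂ lam β γ)
    (hO : CostateObservabilityFloorBody ω₂ lam β γ) : EnergyBudgetGramFloorBody ω₂ lam β γ := by
  intro T hT N hN
  obtain ⟨μ, δ₀, hμ, hδ₀, hfam⟩ := hO T hT N hN
  refine ⟨μ, min δ₀ T, hμ, lt_min hδ₀ hT, fun θ hθ => ?_⟩
  obtain ⟨K, hK, hobs⟩ := hfam θ hθ
  refine ⟨γ * T / (2 * K), by positivity, fun δ hδ s hs hs1 z wp => ?_⟩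
  have hδ₀' : |δ| < δ₀ := lt_of_lt_of_le hδ (min_le_left _ _)
  have hδT : |δ| < T := lt_of_lt_of_le hδ (min_le_right _ _)
  have hTL : 0 < T + δ / 2 := by linarith [(abs_lt.1 hδT).1]
  have hTR : 0 < T - δ / 2 := by linarith [(abs_lt.1 hδT).2]
  have hs0 : 0 < s := by linarith
  set Θ := energyBudget ω₂ lam β γ N (T + δ / 2) (T - δ / 2) θ z wp with hΘ
  have hΘ1 : 1 ≤ Θ := one_le_energyBudget hω hl hβ hγ.le hθ.le z wp
  have hΘμ : 0 < Θ ^ μ := Real.rpow_pos_of_pos (zero_lt_one.trans_le hΘ1) μ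
  have hamp : ampL ω₂ lam β γ (T + δ / 2) ^ 2 = 2 * γ * (T + δ / 2) := ampL_sq ω₂ lam β hγ.le hTL.le
  -- the admissible frame constant
  set η : ℝ := 2 * γ * (T + δ / 2) / (K * Θ ^ μ) with hη
  have hη0 : 0 ≤ η := by positivity
  have hframe : ∀ c : ℝ → PhaseSpace N,
      IsPathCostate ω₂ lam β γ N (T + δ / 2) (T - δ / 2) s z wp c →
        η * dualPair (c s) (c s) ≤ ampL ω₂ lam β γ (T + δ / 2) ^ 2 *
          ∫ r in (0 : ℝ)..s, ((c r).2 ⟨0, by omega⟩) ^ 2 := by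
    intro c hc
    have h := hobs δ hδ₀' s hs hs1 z wp c hc
    rw [hamp, hη, div_mul_eq_mul_div, div_le_iff₀ (by positivity)]
    calc 2 * γ * (T + δ / 2) * dualPair (c s) (c s)
        ≤ 2 * γ * (T + δ / 2) * (K * Θ ^ μ * ∫ r in (0 : ℝ)..s, ((c r).2 ⟨0, by omega⟩) ^ 2) :=
          mul_le_mul_of_nonneg_left h (by positivity)
      _ = 2 * γ * (T + δ / 2) * (∫ r in (0 : ℝ)..s, ((c r).2 ⟨0, by omega⟩) ^ 2) * (K * Θ ^ μ) := by
          ring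
  have hL := hS N hN (T + δ / 2) (T - δ / 2) hTL hTR s hs0 hs1 z wp η hη0 hframe
  refine le_trans (ENNReal.ofReal_le_ofReal ?_) hL
  -- `(γT/(2K)) Θ^{-μ} ≤ η/2 = γ(T + δ/2)/(K Θ^μ)`
  rw [Real.rpow_neg (zero_le_one.trans hΘ1), hη,
    show γ * T / (2 * K) * (Θ ^ μ)⁻¹ = γ * T / 2 * (K * Θ ^ μ)⁻¹ by rw [mul_inv]; ring,
    show 2 * γ * (T + δ / 2) / (K * Θ ^ μ) / 2 = γ * (T + δ / 2) * (K * Θ ^ μ)⁻¹ by ring]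
  have hγT : 0 < γ * (T + δ) := mul_pos hγ (by linarith [(abs_lt.1 hδT).1])
  exact mul_le_mul_of_nonneg_right (by linarith) (inv_nonneg.2 (by positivity))

/-- **(CSF) ∧ (COF) ⇒ (EBF) — PROVED.** [folklore] -/
theorem energyBudgetGramFloor_of_costateFloors (hS : CostateSamplingFloor)
    (hO : CostateObservabilityFloor) : EnergyBudgetGramFloor :=
  fun ω₂ lam β γ hω hl hβ hγ =>
    energyBudgetGramFloorBody_of_costateFloors hω hl.le hβ.le hγ (hS ω₂ lam β γ hω hl hβ hγ)
      (hO ω₂ lam β γ hω hl hβ hγ)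

/-- **(CSF) ∧ (COF) ⇒ (MC∞) — PROVED** (through (EBF) and the theorem (EBM)): the record beneath
the binder of record becomes (MC∞) ⟸ (CSF) ∧ (COF), both measure-free. [folklore] -/
theorem skeletonGramLimitInverseMoments_of_costateFloors (hS : CostateSamplingFloor)
    (hO : CostateObservabilityFloor) : SkeletonGramLimitInverseMoments :=
  skeletonGramLimitInverseMoments_of_energyBudgetGramFloor
    (energyBudgetGramFloor_of_costateFloors hS hO)

end Glue

end Summit.AtomisticToContinuum.FouriersLaw.Theorems.ExtensiveSnapshotIrreversibility.EnergyWindow
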